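import Literature.AlgebraicGeometry.AbelianSchemes.AbelianSchemeKOfLClosedSubscheme
import Literature.AlgebraicGeometry.AbelianSchemes.PolarizationLamEtale
import Literature.AlgebraicGeometry.Motives.AbelianVarietyFiniteSubgroupSubscheme
import Literature.AlgebraicGeometry.Motives.AbelianVarietyTorsionSubschemeEtale
import Literature.AlgebraicGeometry.Limits.SurjectiveSpread
import HarnessLib

/-!
# `K(L) → S` is UNRAMIFIED over a base of characteristic zero; ÉTALE as soon as it is flat
# (Mumford, *Abelian Varieties* §13 with §7 Thm. 4; Görtz–Wedhorn II, Prop. 27.86 / 27.187 / Cor. 27.63)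

Layer `Literature/AlgebraicGeometry/AbelianSchemes`, namespace `Literature.AlgebraicGeometry.AbelianSchemes.AbelianSchemeOver`.
Cell `hodgecm-mathlib` (D-0151), F-DAG leaf F-2c «étaleness of `K(L) → S`» — the `Â`-FREE HALF (file U3 of B-p08 (g12)՚s census
2026-08-30T06:51Z; sequencer B-plan1 (g16) 06:49:21Z GO).  THEOREMS ONLY (no definition but one `def` assembling a ★ structure, no instance,
no named fact, no `sorry`).

ROAD (no Cartier theorem, no dual abelian scheme).  Let `i : Z ↪ A` be a closed immersion over `Spec R` with `Z → Spec R` finite through which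
the unit, the product of the projections and the inverse factor (the shape ★ `AbelianSchemeKOfLClosedSubscheme` /
`…KOfLSeesaw.exists_isClosedImmersion_subgroup_iff_memKOfL*` deliver for `K(L)`).  At a field-valued point `t : Spec K → Spec R` the base
change `Z_t ↪ A_t` is a `FiniteSubgroupSubscheme` of the abelian variety `A_t` (§1, `finiteSubgroupSubschemeFibre`: closed immersions,
finiteness and the three factorisations are stable under the cartesian-monoidal `Over.pullback t` — Mathlib `Functor.map_mul` /
`map_one` / `map_inv'`, `Functor.Monoidal.μ_fst` / `μ_snd`); by DELIGNE (★ U1 `FiniteSubgroupSubscheme.emb_pow_order`, [GortzWedhorn2023]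
Prop. 27.86) `Z_t` is killed by its order `n`, so for `char K = 0` it is a closed subscheme of the étale `A_t[n]` and `Z_t → Spec K` is
ÉTALE (★ U2 `etale_hom_of_pow_eq_one`, [GortzWedhorn2023] Prop. 27.187 / Cor. 27.63) (§2); one field point per `s ∈ Spec R` then makes
`Z → Spec R` FORMALLY UNRAMIFIED (★ `AbelianSchemes.formallyUnramified_left_of_forall_exists_fieldPoint`, [EGAIV4] 17.4.1 / fpqc descent)
for `R` a `ℚ`-algebra (§3), hence ÉTALE whenever it is FLAT (Mathlib `Etale.of_formallyUnramified_of_flat`).  §4 applies this to `K(L)`: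
* **`exists_kOfL_formallyUnramified`** — for every abelian scheme `A` over a Noetherian `ℚ`-algebra `R` and every rigidified rank-one `L`,
  `K(L)` is a closed subscheme `Z ↪ A`, finite (given fibrewise ampleness `hΘ`, ★ p763741) and FORMALLY UNRAMIFIED over `Spec R`;
* **`exists_kOfL_etale_of_flat`** — and ÉTALE over `Spec R` as soon as `Z → Spec R` is flat.
WHAT IS NOT HERE (said, not attempted): FLATNESS of `K(L) → S`.  Over a REDUCED base it would follow from the local constancy of the
geometric fibre cardinality `|K(L_s̄)| = χ(L_s)²` + «finite with constant fibre degree over a reduced Noetherian base ⇒ locally free» —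
two generic bricks the tree does not hold by name; over a NON-reduced base it IS «`Λ(L) : A → Â` is finite flat» ([MumfordFogartyKirwan1994]
Prop. 6.13 (iii)), i.e. the dual abelian scheme over a base (F-DAG leaf F-3, XL).  HC_CM is proved only modulo the 7 printed citations until
rung 0 closes; this file asserts nothing about HC.

## References
* [MumfordAV1970] D. Mumford, *Abelian Varieties* (1970), §7 Thm. 4 (p. 72), §13 (p. 123).
* [GortzWedhorn2023] U. Görtz, T. Wedhorn, *Algebraic Geometry II* (2023), Prop. 27.86 (p. 633), Prop. 27.187, Cor. 27.63, (27.1.1).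
* [GortzWedhorn2020] U. Görtz, T. Wedhorn, *Algebraic Geometry I*, 2nd ed. (2020), Section (4.8) (fibres), Prop. 4.16 (p. 101).
* [MumfordFogartyKirwan1994] D. Mumford, J. Fogarty, F. Kirwan, *GIT*, 3rd ed. (1994), Ch. 6 §2 Prop. 6.13 (iii) (p. 123).
-/

set_option autoImplicit false

noncomputable section

-- `TopCat.Presheaf`/`Scheme.Modules` are not reducible (as in ★ `AbelianSchemeKOfL`).
set_option backward.isDefEq.respectTransparency false

open CategoryTheory CategoryTheory.Limits AlgebraicGeometry MonoidalCategory CartesianMonoidalCategory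

open scoped MonObj

namespace Literature.AlgebraicGeometry.AbelianSchemes

open Literature.AlgebraicGeometry.Motives Literature.AlgebraicGeometry.Motives.AbelianVariety Literature.AlgebraicGeometry.Limits
  Literature.AlgebraicGeometry.AbelianVarieties Literature.AlgebraicGeometry.Modules Literature.AlgebraicGeometry.Morphisms

namespace AbelianSchemeOver

variable {R : Type} [CommRing R] (A : AbelianSchemeOver (Spec (.of R)))

/-! ## §1 Base change of a finite closed subgroup subscheme to a field-valued point of the base -/

section Fibre

variable {Z : Over (Spec (.of R))} (i : Z ⟶ A.X) [IsClosedImmersion i.left] [IsFinite Z.hom]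
  (he : ∃ e : 𝟙_ (Over (Spec (.of R))) ⟶ Z, e ≫ i = 1)
  (hm : ∃ m : Z ⊗ Z ⟶ Z, m ≫ i = (fst Z Z ≫ i) * (snd Z Z ≫ i))
  (hn : ∃ n : Z ⟶ Z, n ≫ i = i⁻¹)
  {K : Type} [Field K] (t : Spec (.of K) ⟶ Spec (.of R))

/-- The base-changed inclusion `Z_t ↪ A_t`, read as a `Z_t`-valued point of the fibre abelian variety `A_t` (reducible plumbing, so that the
group structure on its target is the fibre՚s). [cite: GortzWedhorn2020, Prop. 4.16 (p. 101) and Section (4.8)] -/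
abbrev embFibre : (Over.pullback t).obj Z ⟶ (A.fibre t).toAbelianVariety.X := (Over.pullback t).map i

omit [IsClosedImmersion i.left] [IsFinite Z.hom] in
include he in
/-- The unit factorisation survives base change to a field point (`Over.pullback t` is cartesian monoidal: Mathlib `Functor.map_one`,
unit comparison `ε`). [cite: GortzWedhorn2020, Prop. 4.16 (p. 101)] -/
theorem exists_one_fac_pullback :
    ∃ e : 𝟙_ (SchemeOver K) ⟶ (Over.pullback t).obj Z, e ≫ A.embFibre i t = 1 := by
  obtain ⟨e, he⟩ := he
  refine ⟨Functor.LaxMonoidal.ε (Over.pullback t) ≫ (Over.pullback t).map e, ?_⟩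
  have h : (Over.pullback t).map e ≫ A.embFibre i t = (Over.pullback t).map (1 : 𝟙_ _ ⟶ A.X) := by
    rw [← he, Functor.map_comp]
  rw [Category.assoc, h, Functor.map_one]
  exact MonObj.comp_one _

omit [IsClosedImmersion i.left] [IsFinite Z.hom] in
include hm in
/-- The product factorisation survives base change to a field point (Mathlib `Functor.map_mul`, `Functor.Monoidal.μ_fst` / `μ_snd`).
[cite: GortzWedhorn2020, Prop. 4.16 (p. 101)] -/
theorem exists_mul_fac_pullback :
    ∃ m : (Over.pullback t).obj Z ⊗ (Over.pullback t).obj Z ⟶ (Over.pullback t).obj Z,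
      m ≫ A.embFibre i t =
        (CartesianMonoidalCategory.fst _ _ ≫ A.embFibre i t) * (CartesianMonoidalCategory.snd _ _ ≫ A.embFibre i t) := by
  obtain ⟨m, hm⟩ := hm
  refine ⟨Functor.LaxMonoidal.μ (Over.pullback t) Z Z ≫ (Over.pullback t).map m, ?_⟩
  have h : (Over.pullback t).map m ≫ A.embFibre i t =
      (Over.pullback t).map ((CartesianMonoidalCategory.fst Z Z ≫ i) * (CartesianMonoidalCategory.snd Z Z ≫ i)) := by
    rw [← hm, Functor.map_comp]
  rw [Category.assoc, h, Functor.map_mul, MonObj.comp_mul, Functor.map_comp, Functor.map_comp,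
    Functor.Monoidal.μ_fst_assoc, Functor.Monoidal.μ_snd_assoc]

omit [IsClosedImmersion i.left] [IsFinite Z.hom] in
include hn in
/-- The inverse factorisation survives base change to a field point (Mathlib `Functor.map_inv'`). [cite: GortzWedhorn2020, Prop. 4.16 (p. 101)] -/
theorem exists_inv_fac_pullback :
    ∃ n : (Over.pullback t).obj Z ⟶ (Over.pullback t).obj Z, n ≫ A.embFibre i t = (A.embFibre i t)⁻¹ := by
  obtain ⟨n, hn⟩ := hn
  refine ⟨(Over.pullback t).map n, ?_⟩
  have h : (Over.pullback t).map n ≫ A.embFibre i t = (Over.pullback t).map (i⁻¹) := by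
    rw [← hn, Functor.map_comp]
  rw [h]
  exact Functor.map_inv' (Over.pullback t) i

/-- **The fibre of a finite closed subgroup subscheme at a field point is a finite subgroup scheme of the fibre abelian variety**
(★ `Motives.AbelianVariety.FiniteSubgroupSubscheme`): closed immersions and finiteness are stable under base change (the cartesian square
★ `Limits.isPullback_pullback_map_left`), and so are the three factorisations. [cite: GortzWedhorn2020, Prop. 4.16 (p. 101) and Section (4.8)] -/
def finiteSubgroupSubschemeFibre : FiniteSubgroupSubscheme (A.fibre t).toAbelianVariety where
  Z := (Over.pullback t).obj Z
  emb := A.embFibre i t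
  isClosedImmersion := MorphismProperty.of_isPullback (P := @IsClosedImmersion)
    (isPullback_pullback_map_left t i).flip inferInstance
  isFinite := inferInstanceAs (IsFinite (pullback.snd Z.hom t))
  one_mem := A.exists_one_fac_pullback i he t
  mul_mem := A.exists_mul_fac_pullback i hm t
  inv_mem := A.exists_inv_fac_pullback i hn t

/-! ## §2 The fibres over points of characteristic zero are étale -/

include i he hm hn in
/-- **At a field point of characteristic `0` the fibre `Z_t → Spec K` is ÉTALE**: `Z_t` is killed by its order `n` (Deligne, ★ U1
`FiniteSubgroupSubscheme.emb_pow_order`), `n ≠ 0` in `K`, so `Z_t` is closed in the étale `A_t[n]` (★ U2 `etale_hom_of_pow_eq_one`).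
[cite: GortzWedhorn2023, Prop. 27.86 (p. 633)] [cite: GortzWedhorn2023, Prop. 27.187 and Cor. 27.63] -/
theorem etale_pullback_obj_hom [CharZero K] : Etale ((Over.pullback t).obj Z).hom := by
  let D := A.finiteSubgroupSubschemeFibre i he hm hn t
  haveI : IsClosedImmersion D.emb.left := D.isClosedImmersion
  have hord : ((D.order : ℤ) : K) ≠ 0 := by exact_mod_cast D.order_pos.ne'
  have hpow : D.emb ^ (D.order : ℤ) = 1 := by rw [zpow_natCast]; exact D.emb_pow_order
  exact etale_hom_of_pow_eq_one D.emb (D.order : ℤ) hord hpow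

end Fibre

/-! ## §3 Formal unramifiedness over a `ℚ`-algebra, étaleness given flatness -/

section Unramified

variable {Z : Over (Spec (.of R))} (i : Z ⟶ A.X) [IsClosedImmersion i.left] [IsFinite Z.hom]
  (he : ∃ e : 𝟙_ (Over (Spec (.of R))) ⟶ Z, e ≫ i = 1)
  (hm : ∃ m : Z ⊗ Z ⟶ Z, m ≫ i = (fst Z Z ≫ i) * (snd Z Z ≫ i))
  (hn : ∃ n : Z ⟶ Z, n ≫ i = i⁻¹)

/-- A field-valued point of `Spec R` through a given point `x`, of characteristic `0` when `R` is a `ℚ`-algebra: `Spec κ(𝔭_x) → Spec R`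
(Mathlib `Spec.map_residueFieldIso_inv_eq_fromSpecResidueField`, `Scheme.fromSpecResidueField_apply`). [cite: GortzWedhorn2020, Section (4.8)] -/
theorem exists_fieldPoint_charZero [Algebra ℚ R] (x : Spec (.of R)) :
    ∃ (K : Type) (_ : Field K) (_ : CharZero K) (t : Spec (.of K) ⟶ Spec (.of R)), t (IsLocalRing.closedPoint K) = x := by
  refine ⟨x.asIdeal.ResidueField, inferInstance, ?_, Spec.map (CommRingCat.ofHom (algebraMap R x.asIdeal.ResidueField)), ?_⟩
  · exact charZero_of_injective_ringHom ((algebraMap R x.asIdeal.ResidueField).comp (algebraMap ℚ R)).injective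
  · haveI : Subsingleton ↥(Spec (CommRingCat.of x.asIdeal.ResidueField)) :=
      inferInstanceAs (Subsingleton (PrimeSpectrum x.asIdeal.ResidueField))
    have h1 := Scheme.Spec.map_residueFieldIso_inv_eq_fromSpecResidueField (.of R) x
    have h2 : IsLocalRing.closedPoint x.asIdeal.ResidueField =
        Spec.map (Scheme.Spec.residueFieldIso (.of R) x).inv (IsLocalRing.closedPoint _) := Subsingleton.elim _ _
    rw [h2, ← Scheme.Hom.comp_apply, h1, Scheme.fromSpecResidueField_apply]

include i he hm hn in
/-- **A finite closed subgroup subscheme of an abelian scheme over a `ℚ`-algebra is FORMALLY UNRAMIFIED over the base** (one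
characteristic-`0` field point per `s`, `etale_pullback_obj_hom`, ★ `formallyUnramified_left_of_forall_exists_fieldPoint`).
[cite: GortzWedhorn2023, Prop. 27.86 (p. 633)] [cite: MumfordAV1970, §7 Thm. 4 (p. 72)] -/
theorem formallyUnramified_hom_of_subgroup [Algebra ℚ R] : FormallyUnramified Z.hom := by
  have hlft : LocallyOfFiniteType (toUnit Z).left := by rw [Over.toUnit_left]; infer_instance
  have key : FormallyUnramified (toUnit Z).left := by
    refine formallyUnramified_left_of_forall_exists_fieldPoint (toUnit Z) fun s => ?_
    obtain ⟨K, _, _, t, ht⟩ := exists_fieldPoint_charZero s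
    refine ⟨K, inferInstance, t, ht, ?_⟩
    haveI : Etale ((Over.pullback t).obj Z).hom := A.etale_pullback_obj_hom i he hm hn t
    haveI : FormallyUnramified (((Over.pullback t).map (toUnit Z)).left ≫ ((Over.pullback t).obj (𝟙_ _)).hom) := by
      rw [Over.w]
      exact (Etale.iff_flat_and_formallyUnramified.mp inferInstance).2.1
    exact FormallyUnramified.of_comp _ ((Over.pullback t).obj (𝟙_ (Over (Spec (.of R))))).hom
  rwa [Over.toUnit_left] at key

include i he hm hn in
/-- **… and ÉTALE over the base as soon as it is FLAT** (unramified + flat + locally of finite presentation; the flatness input is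
«`Λ(L) : A → Â` finite flat» / the dual abelian scheme over a base, F-DAG leaf F-3, not attempted here).
[cite: GortzWedhorn2023, Prop. 27.187 and Cor. 27.63] [cite: MumfordFogartyKirwan1994, Ch. 6 §2 Prop. 6.13 (iii) (p. 123)] -/
theorem etale_hom_of_subgroup_of_flat [Algebra ℚ R] [IsNoetherianRing R] [Flat Z.hom] : Etale Z.hom := by
  haveI := A.formallyUnramified_hom_of_subgroup i he hm hn
  haveI : LocallyOfFinitePresentation Z.hom := LocallyOfFinitePresentation.iff_locallyOfFiniteType.mpr inferInstance
  exact Etale.of_formallyUnramified_of_flat _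

end Unramified

/-! ## §4 `K(L)` -/

section KOfL

open SeesawRelative

/-- **`K(L)` IS UNRAMIFIED OVER THE BASE** — for every abelian scheme `A` over a Noetherian `ℚ`-algebra `R` and every rank-one `L` on `A`
rigidified along the identity section and fibrewise of the class of an ample divisor: `K(L)` is a closed subscheme `Z ↪ A`, FINITE and
FORMALLY UNRAMIFIED over `Spec R` (★ `exists_isClosedImmersion_isFinite_iff_memKOfL_of_isNoetherianRing` + ★
`exists_one_mul_inv_fac_of_memKOfL` + `formallyUnramified_hom_of_subgroup`). [cite: MumfordAV1970, §13 (p. 123)] [cite: MumfordAV1970, §7 Thm. 4 (p. 72)]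
[cite: GortzWedhorn2023, Prop. 27.86 (p. 633)] -/
theorem exists_kOfL_formallyUnramified [IsNoetherianRing R] [Algebra ℚ R] {L : A.left.Modules} (hL : HasRank L 1)
    (hε : CechPic.pullback A.unitSection (detClass (HasRank.isFiniteLocallyFree' hL)) = 1)
    (hΘ : ∀ ⦃Ω : Type⦄ [Field Ω] [IsAlgClosed Ω] (s : Spec (.of Ω) ⟶ Spec (.of R)),
      ∃ Θ : CartierDivisor (A.fibre s).toAbelianVariety.X.left, Θ.IsAmple ∧
        CechPic.pullback (X := (A.fibre s).toAbelianVariety.X.left) (pullback.fst A.X.hom s)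
          (detClass (HasRank.isFiniteLocallyFree' hL)) = Θ.cechClass) :
    ∃ (Z : Over (Spec (.of R))) (i : Z ⟶ A.X) (_ : IsClosedImmersion i.left) (_ : IsFinite Z.hom)
      (_ : FormallyUnramified Z.hom),
      ∀ (T : Over (Spec (.of R))) (u : T ⟶ A.X), (∃ v : T ⟶ Z, v ≫ i = u) ↔ A.MemKOfL L u := by
  obtain ⟨Z, i, hci, hfin, hZ⟩ := A.exists_isClosedImmersion_isFinite_iff_memKOfL_of_isNoetherianRing hL hε hΘ
  obtain ⟨he, hm, hn⟩ := A.exists_one_mul_inv_fac_of_memKOfL i hL hε hZ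
  exact ⟨Z, i, hci, hfin, A.formallyUnramified_hom_of_subgroup i he hm hn, hZ⟩

/-- **`K(L)` IS ÉTALE OVER THE BASE AS SOON AS IT IS FLAT** (same hypotheses): the representing closed subscheme `Z ↪ A` is finite and
formally unramified over `Spec R`, and `Etale Z.hom` follows from `Flat Z.hom`. [cite: MumfordAV1970, §13 (p. 123)]
[cite: GortzWedhorn2023, Prop. 27.187 and Cor. 27.63] [cite: MumfordFogartyKirwan1994, Ch. 6 §2 Prop. 6.13 (iii) (p. 123)] -/
theorem exists_kOfL_etale_of_flat [IsNoetherianRing R] [Algebra ℚ R] {L : A.left.Modules} (hL : HasRank L 1)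
    (hε : CechPic.pullback A.unitSection (detClass (HasRank.isFiniteLocallyFree' hL)) = 1)
    (hΘ : ∀ ⦃Ω : Type⦄ [Field Ω] [IsAlgClosed Ω] (s : Spec (.of Ω) ⟶ Spec (.of R)),
      ∃ Θ : CartierDivisor (A.fibre s).toAbelianVariety.X.left, Θ.IsAmple ∧
        CechPic.pullback (X := (A.fibre s).toAbelianVariety.X.left) (pullback.fst A.X.hom s)
          (detClass (HasRank.isFiniteLocallyFree' hL)) = Θ.cechClass) :
    ∃ (Z : Over (Spec (.of R))) (i : Z ⟶ A.X) (_ : IsClosedImmersion i.left) (_ : IsFinite Z.hom)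
      (_ : FormallyUnramified Z.hom),
      (Flat Z.hom → Etale Z.hom) ∧
        ∀ (T : Over (Spec (.of R))) (u : T ⟶ A.X), (∃ v : T ⟶ Z, v ≫ i = u) ↔ A.MemKOfL L u := by
  obtain ⟨Z, i, hci, hfin, hZ⟩ := A.exists_isClosedImmersion_isFinite_iff_memKOfL_of_isNoetherianRing hL hε hΘ
  obtain ⟨he, hm, hn⟩ := A.exists_one_mul_inv_fac_of_memKOfL i hL hε hZ
  exact ⟨Z, i, hci, hfin, A.formallyUnramified_hom_of_subgroup i he hm hn,
    fun _ => A.etale_hom_of_subgroup_of_flat i he hm hn, hZ⟩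

end KOfL

end AbelianSchemeOver

end Literature.AlgebraicGeometry.AbelianSchemes

end
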